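import Literature.Analysis.FluidPDE.NSLocalLerayFarFieldVorticityBypass
import Literature.Analysis.FluidPDE.NSSereginLimitDecayHolds
import Literature.Analysis.FluidPDE.JiaSverak2013CorollaryOneHolds
import HarnessLib

/-!
# Seregin's `L³` blow-up criterion in mild form (`seregin_L3_blowup_mild`) over the live leaves
# of its cone: U (Thm. 14.7), the extension step (Thm. 14.8, Step 2), Jia–Šverák's Lemma 8, S

Analysis/FluidPDE proof file (theorems only: no definition, no named fact, no `sorry`) on the
line of the named fact `Literature.Analysis.FluidPDE.seregin_L3_blowup_mild`
(`NSLerayHopfSereginProofs.lean`; P. G. Lemarié-Rieusset, *The Navier–Stokes Problem in the 21st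
Century* (2016), doi:10.1201/b19556, **Thm. 15.5** "Seregin's theorem", PDF p. 570, proof
pp. 570–573 = G. Seregin, Comm. Math. Phys. 312 (2012), Thm. 1.1: a mild solution in
`C([0, T*), L³)` with `T* < ∞` has `‖u(t)‖₃ → ∞` as `t → T*`).

Along the slab line the fact rests (`seregin_L3_blowup_mild_of_four_leaves`,
`NSLocalLerayFarFieldVorticityBypass.lean`) on four named facts: **U**
`local_leray_weak_strong_uniqueness` (Thm. 14.7), **P** `lemarieRieusset_prop_15_1` (Prop. 15.1),
**F2** `seregin2014_limit_decay` (Seregin 2014, Thm. 1.6 / Lemma B.6) and **S**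
`NSBoundedHigherRegularityBounds` (Seregin–Šverák 2009, §2 p. 8 = Serrin's interior regularity
with the printed dependence of the norms). Two developments of 2026-08-15 shorten this list:

* **F2 is a theorem**: `seregin2014_limit_decay_holds` (`NSSereginLimitDecayHolds.lean`, the
  printed proof of Lemma B.6, (B.2.7)–(B.2.23));
* **P rests on two named facts only**: the accepted reduction
  `lemarieRieusset_prop_15_1_of_extension_facts : localEnergySolution_extension_of_memE2 →
  jia_sverak_2013_corollary_1 → jia_sverak_2013_lemma_8 → lemarieRieusset_prop_15_1`
  (`NSSereginMildProp151.lean`: the first stage of Lemarié-Rieusset's construction is Kato's mild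
  solution, `localEnergySolution_exists_local_of_memLp_three`, and the stages are continued by the
  extension step of Thm. 14.8 and controlled uniformly by Jia–Šverák's Cor. 1 and Lemma 8), in
  which Cor. 1 is now the theorem `jia_sverak_2013_corollary_1_holds`
  (`JiaSverak2013CorollaryOneHolds.lean`, from `jia_sverak_2013_lemma_2_holds`).

This file records the resulting compositions, so that the discharge of the root is the one-line
term

    theorem seregin_L3_blowup_mild_holds : seregin_L3_blowup_mild :=
      seregin_L3_blowup_mild_of_U_X_L8_S local_leray_weak_strong_uniqueness_holds
        localEnergySolution_extension_of_memE2_holds jia_sverak_2013_lemma_8_holds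
        NSBoundedHigherRegularityBounds_holds

once the four remaining `_holds` exist (none does as of 2026-08-15; each is a distinct printed
theorem with its own locator and its own discharge seat):

* **U** `local_leray_weak_strong_uniqueness` — Lemarié-Rieusset 2016, Thm. 14.7 (PDF pp. 514–518),
  reduced in the tree to the local energy inequality for the difference
  (`local_leray_weak_strong_uniqueness_of_energyIneq`, `LocalLerayDifferencePressure.lean`);
* **X** `localEnergySolution_extension_of_memE2` — the extension step, Seregin 2014, App. B §B.5
  = Lemarié-Rieusset 2016, Thm. 14.8, proof, Steps 1–3 (PDF pp. 521–527), reduced in the tree to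
  the unit-time existence of local energy solutions for `E̊₃` data
  (`localEnergySolution_extension_of_memE2_of_unitExistence`, `LocalEnergyExtension.lean`);
* **L8** `jia_sverak_2013_lemma_8` — Jia–Šverák 2013, Lemma 8 (arXiv:1201.1592v1 p. 7 = v2
  Lemma 3.2), the uniform initial layer for `L³` data;
* **S** `NSBoundedHigherRegularityBounds` — Seregin–Šverák 2009, §2 p. 8 (arXiv:0804.1803).

## Main results (all proved; axioms `propext`, `Classical.choice`, `Quot.sound`)

* `lemarieRieusset_prop_15_1_of_extension_of_lemma_8 : X → L8 → lemarieRieusset_prop_15_1`;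
* `lemarieRieusset_backward_uniqueness_slab_of_U_S`, `…_of_U_S` are already in
  `NSLocalLerayFarFieldVorticityBypass.lean` (Thm. 15.4 from U and S);
* `seregin_regular_of_liminf_L3_of_U_X_L8_S : U → X → L8 → S → seregin_regular_of_liminf_L3`;
* `seregin_L3_blowup_mild_of_U_X_L8_S : U → X → L8 → S → seregin_L3_blowup_mild`;
* `seregin_L3_blowup_of_U_X_L8_S : U → X → L8 → S → seregin_L3_blowup` (ns.S08, the
  maximal-smooth form, through `seregin_L3_blowup_of_liminf_L3`).

Nothing accepted is restated or changed; no definition and no named fact is introduced.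

## Mathlib / tree search

Tree (all used by name): `seregin_L3_blowup_mild_of_four_leaves`,
`seregin_regular_of_liminf_L3_of_four_leaves`, `seregin_L3_blowup_of_four_leaves`
(`NSLocalLerayFarFieldVorticityBypass.lean`), `lemarieRieusset_prop_15_1_of_extension_facts`
(`NSSereginMildProp151.lean`), `jia_sverak_2013_corollary_1_holds`
(`JiaSverak2013CorollaryOneHolds.lean`), `seregin2014_limit_decay_holds`
(`NSSereginLimitDecayHolds.lean`). `lean search '_of_live_leaves|prop_15_1_of_extension_of'`:
no clash. `_holds` of U, X, L8, S: none (2026-08-15).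

## References

* P. G. Lemarié-Rieusset, *The Navier–Stokes Problem in the 21st Century*, CRC Press (2016),
  doi:10.1201/b19556 (PDF pages of the held copy): Thm. 15.5 (p. 570) and its proof
  (pp. 570–573); Prop. 15.1 (p. 559, proof pp. 560–564); Thm. 15.4 (p. 568); Thm. 14.7
  (p. 514); Thm. 14.8 and its proof (pp. 520–527). [`LemarieRieusset2016`]
* G. Seregin, Comm. Math. Phys. 312 (2012) 833–845 = arXiv:1104.3615, Thm. 1.1. [`Seregin2012CMP`]
* G. Seregin, *Lecture Notes on Regularity Theory for the Navier–Stokes Equations* (2014),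
  App. B, Thm. 1.6, Lemma B.6, §B.4, §B.5. [`Seregin2014`]
* H. Jia, V. Šverák, SIAM J. Math. Anal. 45 (2013) = arXiv:1201.1592, Cor. 1, Lemma 8.
  [`JiaSverak2013`]
* G. Seregin, V. Šverák, Comm. PDE 34 (2009) = arXiv:0804.1803, §2 p. 8. [`SereginSverak2009`]
-/

noncomputable section

namespace Literature.Analysis.FluidPDE

/-! ### Prop. 15.1 from the extension step and Lemma 8 -/

/-- **Lemarié-Rieusset's Prop. 15.1 from two named facts**: the extension step for local energy
solutions with `E²` data (**X** `localEnergySolution_extension_of_memE2`; Seregin 2014, App. B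
§B.5 = Lemarié-Rieusset 2016, Thm. 14.8, proof, Steps 1–3) and Jia–Šverák's uniform initial
layer (**L8** `jia_sverak_2013_lemma_8`) — the accepted
`lemarieRieusset_prop_15_1_of_extension_facts` with Jia–Šverák's Cor. 1 supplied by its
discharge `jia_sverak_2013_corollary_1_holds`.
[cite: LemarieRieusset2016, Prop. 15.1 (p. 559; proof pp. 560–564; as used pp. 570–571) with Thm. 14.8 and Thm. 15.1 (A)] [cite: JiaSverak2013, Cor. 1 and Lemma 8 (arXiv:1201.1592 pp. 4, 7)] -/
theorem lemarieRieusset_prop_15_1_of_extension_of_lemma_8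
    (hX : localEnergySolution_extension_of_memE2) (hL8 : jia_sverak_2013_lemma_8) :
    lemarieRieusset_prop_15_1 :=
  lemarieRieusset_prop_15_1_of_extension_facts hX jia_sverak_2013_corollary_1_holds hL8

/-! ### Seregin's theorem over the live leaves U, X, L8, S -/

/-- **Seregin's theorem, core form (`seregin_regular_of_liminf_L3`), over the live leaves of its
cone** (Lemarié-Rieusset 2016, proof of Thm. 15.5, PDF pp. 570–573): weak–strong uniqueness for
local Leray solutions (**U**, Thm. 14.7), the extension step (**X**, Thm. 14.8 Step 2 / Seregin
2014 §B.5), Jia–Šverák's Lemma 8 (**L8**) and the quantitative higher regularity of bounded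
solutions (**S**, Seregin–Šverák 2009 §2 p. 8) — `seregin_regular_of_liminf_L3_of_four_leaves`
with Prop. 15.1 from X and L8 and the decay of local energy solutions F2 by its discharge
`seregin2014_limit_decay_holds`.
[cite: LemarieRieusset2016, proof of Thm. 15.5 (PDF pp. 570–573) with Prop. 15.1 and Thm. 15.4] [cite: Seregin2014, Ch. 7 §7.3; App. B Thm. 1.6, §B.4, §B.5] -/
theorem seregin_regular_of_liminf_L3_of_U_X_L8_S (hU : local_leray_weak_strong_uniqueness)
    (hX : localEnergySolution_extension_of_memE2) (hL8 : jia_sverak_2013_lemma_8)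
    (hS : NSBoundedHigherRegularityBounds) : seregin_regular_of_liminf_L3 :=
  seregin_regular_of_liminf_L3_of_four_leaves hU
    (lemarieRieusset_prop_15_1_of_extension_of_lemma_8 hX hL8) seregin2014_limit_decay_holds hS

/-- **Seregin 2012, Thm. 1.1 = Lemarié-Rieusset 2016, Thm. 15.5 in mild `L³` form
(`seregin_L3_blowup_mild`) over the live leaves of its cone**: U (Thm. 14.7), X (the extension
step, Thm. 14.8 Step 2 / Seregin 2014 §B.5), L8 (Jia–Šverák's Lemma 8) and S (Seregin–Šverák
2009 §2 p. 8) — `seregin_L3_blowup_mild_of_four_leaves` with Prop. 15.1 from X and L8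
(`lemarieRieusset_prop_15_1_of_extension_of_lemma_8`) and F2 by `seregin2014_limit_decay_holds`.
Every other printed ingredient of pp. 570–573 — Thm. 15.1 (A), (C), Kato's theory, the limiting
procedure (F1), the decay of the limit (F2), the stability of singular points (Thm. 14.4),
Steps 2–3 of Thm. 15.4 from S, unique continuation, Jia–Šverák's Lemma 2 and Cor. 1 — is a
theorem of the tree. The discharge `seregin_L3_blowup_mild_holds` is this theorem applied to the
four `_holds` (module docstring).
[cite: LemarieRieusset2016, Thm. 15.5 (PDF p. 570; proof pp. 570–573)] [cite: Seregin2012CMP, Thm. 1.1] -/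
theorem seregin_L3_blowup_mild_of_U_X_L8_S (hU : local_leray_weak_strong_uniqueness)
    (hX : localEnergySolution_extension_of_memE2) (hL8 : jia_sverak_2013_lemma_8)
    (hS : NSBoundedHigherRegularityBounds) : seregin_L3_blowup_mild :=
  seregin_L3_blowup_mild_of_four_leaves hU
    (lemarieRieusset_prop_15_1_of_extension_of_lemma_8 hX hL8) seregin2014_limit_decay_holds hS

/-- **Seregin 2012, Thm. 1.1 in the tree's maximal-smooth form (ns.S08 `seregin_L3_blowup`) over
the same four live leaves** (`seregin_L3_blowup_of_four_leaves`, i.e.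
`seregin_L3_blowup_of_liminf_L3` with the core form).
[cite: Seregin2012CMP, Thm. 1.1] [cite: LemarieRieusset2016, Thm. 15.5 with Thm. 15.13, Thm. 15.1 (A), (C)] -/
theorem seregin_L3_blowup_of_U_X_L8_S (hU : local_leray_weak_strong_uniqueness)
    (hX : localEnergySolution_extension_of_memE2) (hL8 : jia_sverak_2013_lemma_8)
    (hS : NSBoundedHigherRegularityBounds) : seregin_L3_blowup :=
  seregin_L3_blowup_of_four_leaves hU
    (lemarieRieusset_prop_15_1_of_extension_of_lemma_8 hX hL8) seregin2014_limit_decay_holds hS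

end Literature.Analysis.FluidPDE

end
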